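import Summits.QuantumFields.YangMills.Theorems.BalabanUVNodesN22SocketNonOwnerBindersJointWitness
import Summits.QuantumFields.YangMills.Theorems.BalabanUVNodesN22KernelSlotThresholdLocatedSize

/-!
# BalabanUVNodes ∕ node N22 = NE9 — module J93: THE ROAD-2 SOCKET OF RECORD J89's NON-OWNER BINDERS **ON THE CENSUS FLOOR** `κ₀(64,8) ≤ ℓ.κ` — JOINTLY INHABITED AT
# `consts` FOR EVERY BLOCK COUNT WHOSE RATE RANGE IS NONEMPTY (the positive half of director-ym №276 (2), kernel form, N22 end)

Cell `pub-ymgap`, HUMAN RULING D-0062 (Track A), R134 seat `pub-ymgap-dag-n22-c` (strategy s1), generation 24, module J93.  THEOREMS ONLY (no `def`, no `sorry`,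
standard axioms); `--kind proof --supports stmt-QuantumFields-27366 --as helper` (K3⁸), COUNT-NEUTRAL.  Imports this lane's J90 `…N22SocketNonOwnerBindersJointWitness`
(p707076 ∕ v1.1 p707931: the certificate WITHOUT the floor, at `ℓ.κ ≤ ½`; its import closure = J89, J88-W′, dag-n18-c's numerals) and J92 `…N22KernelSlotThresholdLocatedSize`
(p709559: `325 < κ₀(64,8) < 327`, the necessity half).  Nothing re-declared.

WHY.  Director-ym №276 (2026-08-29) booked dag-n27-c's ⚑ LOCATED-SIZE «one letter ℓ.κ, two printed rates»: node N19′'s `hlink` puts the ACTIVITY animal-census floor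
`kappa₀ (4 * 2 ^ d₀) (2 * d₀) ≤ R.u3.κ` on the kernel slot that this lane's socket J89 caps by (5.10)'s rate, `hℓκ : ℓ.κ ≤ delta1 δ₀ κ ((M : ℝ) * 4)`; №276 (2) records
that the joint letters «remain SATISFIABLE … but AS TYPED any future INHABITATION … must supply δ₀ ≥ 651 ∕ κ_tree ≥ 2605·M».  J92 proved the necessity half on J89's row
types (`2κ₀ ≤ δ₀`, `8Mκ₀ ≤ κ ≤ κE ≤ r₁`, `κ₀ ≤ κ₅`, `M ≤ 4` at `consts`, `M ≤ 2` on J90's rate range).  THIS FILE is the SUFFICIENCY half at this lane's end, by the kernel: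
★ `socketNonOwnerBinders_inhabited_onFloor` — for every `F M L sp γ`, N18 letters `0 < θ₅ < 1`, `C₅`, chart letters `B₃ r`, every renewal size `E₀ ≥ e·9·64·K₀²·C₃ε₁`,
EVERY KERNEL-STEP RATE **`κ₅ ≥ κ₀(64,8)`** (the located price on node N18's letter, J92 §1) and EVERY HISTORY DECAY RATE **`r₁ ∈ [8M·κ₀(64,8), consts.κ − 1]`** (the located
price on NODE A's admissible class; the interval is nonempty iff `M ≤ 2`, J92 `floorSized_in_certificateRange_iff` — for `M ≥ 3` the statement is vacuously universal and
says nothing), there exist `ℓ` and the lane-side reals ∕ weights ∕ coupling sets ∕ term-data family ∕ readings such that **the floor `kappa₀ (4 * 2 ^ 4) (2 * 4) ≤ ℓ.κ`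
AND every one of J89's 45 non-owner binders hold AT ONCE** (bodies VERBATIM as in J90 §2: `c := consts`, `ρ_b := 1∕100`, `a₅ := ½`, `a₂ = a₂′ = Aabs := 1`, `θ.γ := γ`).
Values: as J90 except `δ₀ := 2κ₀′`, `κ := κE := 8M·κ₀′` (κ₀′ := `kappa₀ (4 * 2 ^ 4) (2 * 4)` = κ₀(64,8)), whence `delta1 δ₀ κ (4M) = ½ min{2κ₀′, 8Mκ₀′∕(4M)} = κ₀′` EXACTLY —
the kernel letter `ℓ.κ := delta1 δ₀ κ (4M)` sits ON the floor, `hκ₅` reads `κ₀′ ≤ κ₅`, `hκr` reads `8Mκ₀′ ≤ r₁`.  §1 `delta1_onFloor` is that computation; §3 ★ repeats §2 with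
J89's `hLc : c.L = L` verbatim (as J90 v1.1 §3).
WHAT IT SAYS AND DOES NOT SAY.  The census floor is jointly inhabitable with the N22 socket's displayed non-owner rows at the ONLY certified constants record — at the located
prices `κ₅ ≥ 325.6`, `δ₀ = 651.2`, `κ = κE = 2604.9·M ≤ r₁ ≤ 7791`, hence `M ≤ 2` — and NOT otherwise on this range (J92); print has δ₀ = O(1) (p.282), δ₁ = ½ min{δ₀, κM⁻¹} (p.293) and
«we choose the size M much bigger than the previously fixed scales» ([I] p.257).  It inhabits NO owner hypothesis of J89 (`hlim h5 hloc hι hloc18`, reading laws, chart) and claims no joint inhabitant of J89's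
whole antecedent; the datum is J88-W′'s DEGENERATE one (free kernels, zero potentials, indicator boxes — not Bałaban's objects); `consts` is formal (K₀ ≈ e^{321}).

HONEST FRAMING (binding).  A2 JOINT-INHABITATION bookkeeping (№274 (v) ∕ №276 (2)) in kernel form; nothing of Bałaban's asserted or denied; no statement of record edited
(DO-NOT-REKEY №265–№269); N22 NOT discharged; K3⁸ OPEN; counts UNMOVED; one finite 𝕋⁴ programme at fixed ε — NOTHING about the continuum, ℝ⁴, OS, a mass gap or Clay.
References (TYPES only): [I] = Bałaban, CMP 109 (1987) p. 257 (M-cubes, d_j), (1.18) p. 263, (1.20)–(1.22) p. 264, (5.10) p. 293; [II] = CMP 116 (1988) (2.16)–(2.26)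
pp. 16–17, (2.38)–(2.41) pp. 20–21 and the closing paragraph p. 21; Kotecký–Preiss, CMP 103 (1986) p. 492.
-/

noncomputable section

open Set Metric
open scoped BigOperators Matrix

namespace YMDAG.N22.KernelFading

open Literature.MathematicalPhysics.QuantumFieldTheory.Balaban1983to89
open Literature.MathematicalPhysics.QuantumFieldTheory.Balaban1983to89.T4Continuum (T4Family)
open Literature.MathematicalPhysics.QuantumFieldTheory.Balaban1983to89.TreeLengthTorus (TPt TDom tsys)
open Literature.MathematicalPhysics.QuantumFieldTheory.Balaban1983to89.B9Thm37GlueTorus (tdist1)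
open Literature.MathematicalPhysics.QuantumFieldTheory.Balaban1983to89.B12TreeDecay (K₀ kappa₀ K₀_pos kappa₀_nonneg)
open Literature.MathematicalPhysics.QuantumFieldTheory.Balaban1983to89.B12Decay510 (delta1 delta1_le_half delta1_nonneg)
open Literature.MathematicalPhysics.QuantumFieldTheory.Balaban1983to89.B12Decay510Window (K₁)
open Literature.MathematicalPhysics.QuantumFieldTheory.Balaban1983to89.B13Lemma3TorusTerms (terms)
open Literature.MathematicalPhysics.QuantumFieldTheory.Balaban1983to89.B13Lemma3TorusSocket (Lemma3Numerics)
open Literature.MathematicalPhysics.QuantumFieldTheory.Balaban1983to89.B13Lemma3WindowNonvacuity (κ₀w κw α₆w ε₂w)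
open Literature.MathematicalPhysics.QuantumFieldTheory.Balaban1983to89.B13Lemma3TorusNonvacuity (κ₁t consts numerics_nonvacuous_pos_consts consts_L)
open Literature.MathematicalPhysics.QuantumFieldTheory.Balaban1983to89.Node00 (U3Letters₁₁)
open Literature.MathematicalPhysics.QuantumFieldTheory.Balaban1983to89.Node00.Sect2 (domSys domCount CPair)
open Literature.MathematicalPhysics.QuantumFieldTheory.Balaban1983to89.Node00.W1
open Summit.QuantumFields.YangMills.BalabanUVNodes.N18HLayerW1NumeralsStrict (eps2_consts_eq alpha6w_lt_one witness_signs strictKP_of_le_one_of_lt)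
open YMDAG.N22.W1 (lemma3Numerics_consts_anyM socketFamilies_inhabited_lemma2_half)


/-! ## §1 The rate computation on the floor -/

/-- **ON THE FLOOR, (5.10)'s EXAMPLE RATE IS THE FLOOR ITSELF**: `delta1 (2x) (2M′x) M′ = ½·min{2x, 2M′x∕M′} = x` (`M′ > 0`).  With `M′ = 4M`, `δ₀ := 2κ₀′`, `κ := 8Mκ₀′`
this puts `ℓ.κ := delta1 δ₀ κ (4M)` exactly at `κ₀′`. [cite: Balaban1987RG1, (5.10) p.293 (δ₁ = ½ min{δ₀, κM⁻¹}; bookkeeping)] -/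
theorem delta1_onFloor (x : ℝ) {M' : ℝ} (hM : 0 < M') : delta1 (2 * x) (2 * M' * x) M' = x := by
  unfold delta1
  rw [show 2 * M' * x / M' = 2 * x by field_simp, min_self]
  ring

/-! ## §2 ★ Every non-owner binder of J89 AND the census floor, jointly -/

variable (F : T4Family) {𝔸 : Type} [NormedRing 𝔸] [NormedAlgebra ℂ 𝔸]

open Classical in
/-- ★ **THE ROAD-2 SOCKET OF RECORD's NON-OWNER BINDERS ON THE CENSUS FLOOR, JOINTLY** — for every parameter tower `F`, block count `M`, block size `L` (the `hLc`
conjunct is the `L`-free `consts.L = 8`; §3 takes `consts.L = L` verbatim), table system `sp`, window `γ`, N18 letters `0 < θ₅ < 1` and `C₅`, chart letters `B₃, r`, every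
renewal size `E₀ ≥ e·9·64·K₀(64,8)²·C₃ε₁`, EVERY kernel-step rate ON THE FLOOR `κ₀′ ≤ κ₅` and EVERY history decay rate `8M·κ₀′ ≤ r₁ ≤ consts.κ − 1` (nonempty iff `M ≤ 2`,
module J92), there exist `ℓ` (`ℓ.θ₅ = θ₅`, `ℓ.Signs`, **`κ₀′ ≤ ℓ.κ`** — the census floor of `hlink` ∕ node N27's `hκ₀` row), reals `a κ κE δ₀ R ϱ Mb cw cS cA Mv Bq b`, weights
`aw`, coupling sets `D`, a term-data family `𝔇` over `consts` with readings `χᵘ χᶜᵘ 𝒲 𝒪` such that J89's binders `hL hLc hκ₁ hα₆ hN hκ₀ hδ₀ hκE hκE0 hE₀ hA0 hr₁ hrate hKP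
hκr hrenew hrenewE hawcw hC1 hMb0 hϱ hR hcS hcSA hcA1 hρb hBq hsmall2 hMv hBqv hρb1 hb hbaw hκ₅ hω hθω hℓκ hC₉ hD hlaw hBox hχ1 hWm hιc` ALL hold (bodies VERBATIM at
`c := consts`, `ρ_b := 1∕100`, `a₅ := ½`, `a₂ = a₂′ = Aabs := 1`, `θ.γ := γ`; `κ₀′ := kappa₀ (4 * 2 ^ 4) (2 * 4)`).  Values as module J90 except `δ₀ := 2κ₀′`,
`κ := κE := 8Mκ₀′` (so `ℓ.κ := delta1 δ₀ κ (4M) = κ₀′`).  A2 bookkeeping at degenerate data and the witness constants; nothing of Bałaban's; N22 NOT discharged.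
[cite: Balaban1988RG2Cluster, p.21 (closing paragraph: "The assumptions allow finally us to fix all the constants"), (2.16)–(2.26) pp.16–17 (the located letters; bookkeeping); Balaban1987RG1, (5.10) p.293] -/
theorem socketNonOwnerBinders_inhabited_onFloor (M L : ℕ) [NeZero M] [NeZero L] (sp : (K j : ℕ) → (domSys (F.P K) M j).Dom → Set (CPair (F.P K) 𝔸))
    (γ : ℝ) {θ₅ κ₅ : ℝ} (C₅ B₃ r : ℝ) {E₀ r₁ : ℝ} (hθ₅ : 0 < θ₅) (hθ₅1 : θ₅ < 1) (hκ₅ : kappa₀ (4 * 2 ^ 4) (2 * 4) ≤ κ₅)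
    (hE₀ : Real.exp 1 * 9 * 64 * K₀ 64 8 ^ 2 * (consts.C3act * consts.ε₁) ≤ E₀)
    (hr₁ : 8 * (M : ℝ) * kappa₀ (4 * 2 ^ 4) (2 * 4) ≤ r₁) (hr₁' : r₁ ≤ consts.κ - 1) :
    ∃ (ℓ : U3Letters₁₁) (a κ κE δ₀ R ϱ Mb cw cS cA Mv Bq b : ℝ) (aw : ℕ → ℕ → ℕ → ℝ) (D : ℕ → Set ℂ)
      (𝔇 : (K : ℕ) → TermData214 consts (F.P K) 𝔸 M L) (χu χcu : (K k : ℕ) → (𝔇 K k).UnscaledChi) (𝒲 : (K k : ℕ) → (𝔇 K k).UnscaledWilson)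
      (𝒪 : (K k : ℕ) → (𝔇 K k).UnscaledOlder),
      -- the bill's letter record carries N18's rate and the displayed signs, AND ITS KERNEL LETTER SITS ON THE CENSUS FLOOR (`hlink` ∕ node N27's `hκ₀`)
      ℓ.θ₅ = θ₅ ∧ ℓ.Signs ∧ kappa₀ (4 * 2 ^ 4) (2 * 4) ≤ ℓ.κ ∧
      -- hL hLc hκ₁ hα₆ hN : the numerics record of record
      8 ≤ consts.L ∧ consts.L = 8 ∧ 1 ≤ consts.κ₁ ∧ consts.α₆ ≠ 0 ∧ Lemma3Numerics consts M ((consts.L : ℝ) / 2) a 1 1 (1 / 2) 1 ∧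
      -- hκ₀ hδ₀ hκE hκE0 hE₀
      kappa₀ (4 * 2 ^ 4) (2 * 4) ≤ κ / 2 ∧ 0 < δ₀ ∧ κ ≤ κE ∧ 0 ≤ κE ∧ 0 ≤ E₀ ∧
      -- hA0 hr₁ hrate hKP hκr hrenew hrenewE hawcw hC1 hMb0 hϱ hR
      0 ≤ consts.C3act * consts.ε₁ ∧ 0 ≤ r₁ ∧ r₁ + 2 * (64 * Real.log 162) + 2 ≤ (1 - 8 * consts.δ) * ((consts.L : ℝ) / 2) * consts.κ ∧
      consts.C3act * consts.ε₁ * Real.exp (5 * r₁ + 1) * K₀ 64 8 * 9 * 64 < 1 ∧ κE ≤ r₁ ∧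
      Real.exp 1 * 9 * 64 * K₀ 64 8 ^ 2 * (consts.C3act * consts.ε₁) ≤ Mb ∧ Real.exp 1 * 9 * 64 * K₀ 64 8 ^ 2 * (consts.C3act * consts.ε₁) ≤ E₀ ∧
      (∀ K k j : ℕ, aw K k j ≤ cw) ∧ 4 * Mb * cw / ϱ < 1 ∧ 0 ≤ Mb ∧ 0 < ϱ ∧ cw * E₀ + ϱ < R ∧
      -- hcS hcSA hcA1 hρb hBq hsmall2 hMv hBqv hρb1 (ρ_b = 1∕100)
      0 < cS ∧ cS < cA ∧ cA < 1 ∧ cA / (1 - cA) < (1 / 100 : ℝ) ∧ 0 ≤ Bq ∧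
      2 * (consts.C3act * consts.ε₁) * Real.exp (5 * r₁ + 1) * K₀ 64 8 * 9 * 64 ≤ 1 ∧ 0 ≤ Mv ∧
      2 * (Real.exp 1 * 9 * 64 * K₀ 64 8 ^ 2 * (2 * (consts.C3act * consts.ε₁))) * ((1 - cA)⁻¹ ^ 2 * Mv) * (1 + cS) ^ 2 ≤ Bq ∧ (1 / 100 : ℝ) < 1 ∧
      -- hb hbaw
      0 < b ∧ (∀ K k j : ℕ, b ≤ aw K k j) ∧
      -- hκ₅ hω hθω hℓκ hC₉ (θ.γ := γ)
      delta1 δ₀ κ ((M : ℝ) * 4) ≤ κ₅ ∧ 0 < ℓ.ω ∧ ℓ.θ₅ ≤ ℓ.ω ^ 2 ∧ ℓ.κ ≤ delta1 δ₀ κ ((M : ℝ) * 4) ∧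
      (4 * (2 * C₅ / (1 - ℓ.θ₅) + 2 * ((16 * Mb * B₃ ^ 2 / r ^ 2) * Real.exp (delta1 δ₀ κ ((M : ℝ) * 4) * ((M : ℝ) * 4) * 3) * K₀ (4 * 2 ^ 4) (2 * 4) * K₁ 4 (δ₀ / 2))) / γ +
        ((16 * max ((6 * cS ^ 2 + 32 * cS + 64) / cS ^ 2 * Bq) (64 * Mb * cw ^ 2 / ϱ ^ 2 * (Bq * γ / cS) ^ 2 / (1 - 4 * Mb * cw / ϱ)) * B₃ ^ 2 / r ^ 2) *
          Real.exp (delta1 δ₀ κ ((M : ℝ) * 4) * ((M : ℝ) * 4) * 3) * K₀ (4 * 2 ^ 4) (2 * 4) * K₁ 4 (δ₀ / 2)) * γ / 2) / ℓ.ω ≤ ℓ.C₉ ∧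
      -- hD
      (∀ K : ℕ, ∀ t ∈ Ioc (0 : ℝ) γ, ((t : ℝ) : ℂ) ∈ D K) ∧
      -- hlaw hBox hχ1 hWm hιc (module J88-W′ §2)
      (∀ K, (𝔇 K).UnscaledFieldLawOn (χu K) (χcu K) (𝒲 K) (𝒪 K) γ) ∧
      (∀ (K k : ℕ) (Z : (domSys (F.P K) M (k + 1)).Dom) (s : TermLabel (F.P K) M k L), (𝔇 K k).UnscaledBoxLaws (χu K k) (χcu K k) Z s) ∧
      (∀ (K k : ℕ) (Z : (domSys (F.P K) M (k + 1)).Dom) (s : TermLabel (F.P K) M k L) (A : ((𝔇 K k).𝒦 Z s).Λ → ℝ), χu K k Z s A * χcu K k Z s A ≤ 1) ∧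
      (∀ (K k : ℕ) (Z : (domSys (F.P K) M (k + 1)).Dom) (t : TermLabel (F.P K) M k L) (φ : CPair (F.P K) 𝔸) (Y : TDom (F.P K).d (L * domCount (F.P K) M (k + 1))),
        Measurable fun B : ((𝔇 K k).𝒦 Z t).Λ → ℝ => 𝒲 K k Z t φ Y B) ∧
      (∀ (K k : ℕ) (old : OlderTerms (F.P K) 𝔸 M k), old ∈ AdmHist (sp K) E₀ r₁ k ∧ old 0 = 0 → ∀ (X : (domSys (F.P K) M (k + 1)).Dom), ∀ φ ∈ sp K (k + 1) X,
      ∀ Z : (domSys (F.P K) M (k + 1)).Dom, Subtype.val Z ⊆ Subtype.val X → ∀ s ∈ terms L M Z, ∀ t ∈ Ioc (0 : ℝ) γ,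
        ∃ ι : (𝔇 K k).Inputs226Holo consts Z s ((t : ℝ) : ℂ) old φ a (1 / 2), ∃ ag : (𝔇 K k).AnalyticGrowthInputs (χu K k) (𝒲 K k) (𝒪 K k) Z s old φ ι.Uτ,
        ∃ KE KG' KCs' θΓ' θC' θE' am wm δ : ℝ,
          0 ≤ KE ∧
          (∀ b b', ‖(((𝔇 K k).𝒦 Z s).C⁻¹.map (algebraMap ℝ ℂ)) b b'‖ ≤
            KE * Real.exp (-(ι.kap * tdist1 (𝔇 K k).Nf (((𝔇 K k).𝒦 Z s).locΛ b) (((𝔇 K k).𝒦 Z s).locΛ b')))) ∧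
          (1 + (1 / 100 : ℝ)) * ι.KG ≤ KG' ∧ ((1 - (1 / 100 : ℝ)) ^ 2)⁻¹ * ι.KCs ≤ KCs' ∧ ι.θΓ + (1 / 100 : ℝ) * ι.KG ≤ θΓ' ∧
          ι.θC + (1 / 100 : ℝ) * (2 + (1 / 100 : ℝ)) * ((1 - (1 / 100 : ℝ)) ^ 2)⁻¹ * ι.KCs ≤ θC' ∧ ι.θE + (1 / 100 : ℝ) * (2 + (1 / 100 : ℝ)) * (ι.θE + KE) ≤ θE' ∧ θE' ≤ ι.θ ∧ θΓ' ≤ ι.θ ∧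
          ((((𝔇 K k).𝒦 Z s).m * (1 + 2 / (ι.kap - ι.kap')) ^ (𝔇 K k).ν) * (((𝔇 K k).𝒦 Z s).m * (1 + 2 / (ι.kap' - ι.kap'')) ^ (𝔇 K k).ν)
            * (θΓ' * KCs' * KG' + ι.KΓ * θC' * KG' + ι.KΓ * ι.K₀ * θΓ') ≤ ι.θ) ∧
          (1 + (1 / 100 : ℝ)) ^ 2 * (2 * ag.ρ * (ag.Cp * K₀ (4 * 2 ^ (F.P K).d) (2 * (F.P K).d))) ≤ am ∧ (1 + (1 / 100 : ℝ)) ^ 2 * (∑ Y ∈ s.1, ag.Rτ Y * (ag.M𝒪 Y + (2 * ag.M𝒪 Y / ag.R) * ag.ρ)) ≤ wm ∧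
          0 < δ ∧ 2 * δ + 8 * ag.ρ * (ag.Cp * K₀ (4 * 2 ^ (F.P K).d) (2 * (F.P K).d)) ≤ am ∧
          Real.exp (∑ Y ∈ s.1, ag.Rτ Y * ag.M𝒪 Y)
              * ((∑ Y ∈ s.1, ag.Rτ Y * ((4 * (2 * ag.M𝒲 Y / ag.R ^ 4) + (4 * (ag.M𝒲 Y / ag.R ^ 3) + 4 * (ag.M𝒲 Y / ag.R ^ 3)) / ag.ρ) * (4 / (Real.exp 1 * δ)) ^ 4
                    + ((4 * ag.M𝒪 Y / ag.R ^ 2) + ((2 * ag.M𝒪 Y / ag.R) + (2 * ag.M𝒪 Y / ag.R)) / ag.ρ) * (2 / (Real.exp 1 * δ)) ^ 2)) * Real.exp (δ / 2)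
                 + ((∑ Y ∈ s.1, ag.Rτ Y * (4 * (ag.M𝒲 Y / ag.R ^ 3) * (3 / (Real.exp 1 * δ)) ^ 3 + (2 * ag.M𝒪 Y / ag.R) * (1 / (Real.exp 1 * δ))))
                      * Real.exp (δ / 2)) ^ 2
                    * Real.exp ((∑ Y ∈ s.1, ag.Rτ Y * (ag.M𝒪 Y + (2 * ag.M𝒪 Y / ag.R) * ag.ρ)) + ∑ Y ∈ s.1, ag.Rτ Y * ag.M𝒪 Y))
              ≤ Real.exp wm ∧
          (2 * (ι.θ * (((𝔇 K k).𝒦 Z s).m * (1 + 2 / ι.kap'') ^ (𝔇 K k).ν)) + (ι.γ₂ + am)) * ι.cE ≤ 1 / 2 ∧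
          (2 * (ι.θ * (((𝔇 K k).𝒦 Z s).m * (1 + 2 / ι.kap'') ^ (𝔇 K k).ν)) + (ι.γ₂ + am)) * (1 + 2 * ι.cE * ι.g) ≤ 1 / 2 ∧
          2 * (ι.K₀ * (((𝔇 K k).𝒦 Z s).m * (1 + 2 / ι.kap) ^ (𝔇 K k).ν) * (ι.θ * (((𝔇 K k).𝒦 Z s).m * (1 + 2 / ι.kap'') ^ (𝔇 K k).ν))
              * (1 + (1 - ι.K₀ * (((𝔇 K k).𝒦 Z s).m * (1 + 2 / ι.kap) ^ (𝔇 K k).ν) * (ι.θ * (((𝔇 K k).𝒦 Z s).m * (1 + 2 / ι.kap'') ^ (𝔇 K k).ν)))⁻¹) / 2)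
              * (Fintype.card ((𝔇 K k).𝒦 Z s).Λ : ℝ)
            + wm + (2 * (ι.θ * (((𝔇 K k).𝒦 Z s).m * (1 + 2 / ι.kap'') ^ (𝔇 K k).ν)) + (ι.γ₂ + am)) * ι.cE * (Fintype.card ((𝔇 K k).𝒦 Z s).Λ : ℝ)
            + (2 * (ι.θ * (((𝔇 K k).𝒦 Z s).m * (1 + 2 / ι.kap'') ^ (𝔇 K k).ν)) + (ι.γ₂ + am)) * (1 + 2 * ι.cE * ι.g)
              * (Fintype.card (((𝔇 K k).𝒦 Z s).Λ ⊕ ((𝔇 K k).𝒦 Z s).C₀) : ℝ)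
            ≤ 1 / 2 * ((Z.1).card : ℝ) ∧
          (s.2.card = 0 → ∃ κb Rb T : ℝ, 0 ≤ κb ∧ κb ≤ ι.γ₂ + am ∧
            (∀ B : ((𝔇 K k).𝒦 Z s).Λ → ℝ, B ⬝ᵥ B < Rb ^ 2 → χu K k Z s (t • B) * χcu K k Z s (t • B) = 1) ∧
            Real.exp (-(κb / 2 * Rb ^ 2)) ≤ T * t ^ 2 ∧ 1 + T ≤ Mv) ∧
          (s.2.card ≠ 0 → ∃ r₁' T' : ℝ, r₁' ^ 2 ≤ ι.rP ^ 2 ∧ a ≤ ι.γ₂ * r₁' ^ 2 ∧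
            Real.exp (-(ι.γ₂ / 2 * (ι.rP ^ 2 - r₁' ^ 2))) ≤ T' * t ^ 2 ∧ T' ≤ Mv)) := by
  obtain ⟨c1, -, c3, c4, -, -, -, c8, -, -, -, -, -, -, -, -, -, -, -, -, -, -, -, -, -, -, -, -, c29, c30, c31, -, -, -, -, -, -, c38, -, c40, -⟩ :=
    numerics_nonvacuous_pos_consts
  -- W1-8's elementary conditions at `consts`, and the datum side (J88-W′ §2) at `a := aw + 40M`, `Mv := 2`
  have hEc : 0 < consts.E₀ := by linarith
  have hC₁ : 0 < consts.C₁ := by show (0 : ℝ) < 1; norm_num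
  have hα₄ : 0 < consts.α₄ := by show (0 : ℝ) < 1; norm_num
  have hMc : 0 < consts.M := by
    show (0 : ℝ) < κw + 1
    have : 0 ≤ κw := by unfold κw κ₀w; linarith [kappa₀_nonneg (by norm_num : (0 : ℝ) ≤ 64) 8]
    linarith
  have hδκ : 0 ≤ (1 - 3 * consts.δ) * consts.κ := mul_nonneg (by show (0 : ℝ) ≤ 1 - 3 * (3 / 40); norm_num) c8
  obtain ⟨𝔇, χu, χcu, 𝒲, 𝒪, hlaw, hBox, hχ1, hWm, hιc⟩ := socketFamilies_inhabited_lemma2_half F M L c40 hEc c3 hC₁ hα₄ hMc hδκ pref_consts sp E₀ r₁ γ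
    (B13Lemma3WindowNonvacuity.aw + 40 * (M : ℝ)) (Mv := 2) (by norm_num)
  -- the lane-side reals: ON THE FLOOR — `δ₀ := 2κ₀′`, `κ := κE := 8Mκ₀′`, so `delta1 δ₀ κ (4M) = κ₀′`
  have eκ₀ : kappa₀ (4 * 2 ^ 4) (2 * 4) = kappa₀ 64 8 := by norm_num
  have hκ₀pos : 0 < kappa₀ (4 * 2 ^ 4) (2 * 4) := by rw [eκ₀]; linarith [kappa₀_64_8_gt]
  have hκ₀0 : 0 ≤ kappa₀ (4 * 2 ^ 4) (2 * 4) := hκ₀pos.le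
  have hM0 : (0 : ℝ) < (M : ℝ) := by exact_mod_cast Nat.pos_of_ne_zero (NeZero.ne M)
  have hM1 : (1 : ℝ) ≤ (M : ℝ) := by exact_mod_cast Nat.pos_of_ne_zero (NeZero.ne M)
  have hM4 : (0 : ℝ) < (M : ℝ) * 4 := by positivity
  have hr₁0 : 0 ≤ r₁ := le_trans (by positivity) hr₁
  set κ : ℝ := 8 * (M : ℝ) * kappa₀ (4 * 2 ^ 4) (2 * 4) with hκdef
  have hκpos : 0 < κ := by rw [hκdef]; positivity
  set δ₀ : ℝ := 2 * kappa₀ (4 * 2 ^ 4) (2 * 4) with hδ₀def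
  have hδ₀ : 0 < δ₀ := by rw [hδ₀def]; positivity
  have hd1eq : delta1 δ₀ κ ((M : ℝ) * 4) = kappa₀ (4 * 2 ^ 4) (2 * 4) := by
    rw [hδ₀def, hκdef, show 8 * (M : ℝ) * kappa₀ (4 * 2 ^ 4) (2 * 4) = 2 * ((M : ℝ) * 4) * kappa₀ (4 * 2 ^ 4) (2 * 4) by ring]
    exact delta1_onFloor _ hM4
  have hd1 : 0 ≤ delta1 δ₀ κ ((M : ℝ) * 4) := by rw [hd1eq]; exact hκ₀0
  have hd1κ₅ : delta1 δ₀ κ ((M : ℝ) * 4) ≤ κ₅ := by rw [hd1eq]; exact hκ₅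
  set mstar : ℝ := Real.exp 1 * 9 * 64 * K₀ 64 8 ^ 2 * (consts.C3act * consts.ε₁) with hmdef
  have hm0 : 0 ≤ mstar := mul_nonneg (by positivity) c29
  set cw : ℝ := 1 / (8 * mstar + 8) with hcwdef
  have hcw0 : 0 < cw := by rw [hcwdef]; exact div_pos one_pos (by linarith)
  set ω : ℝ := (1 + θ₅) / 2 with hωdef
  have hω0 : 0 < ω := by rw [hωdef]; linarith
  have hω1 : ω < 1 := by rw [hωdef]; linarith
  have hθω : θ₅ ≤ ω ^ 2 := by rw [hωdef]; nlinarith [sq_nonneg (1 - θ₅)]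
  have hθρ : θ₅ ≤ ω := by rw [hωdef]; linarith
  have hBq0 : 0 ≤ 2 * (Real.exp 1 * 9 * 64 * K₀ 64 8 ^ 2 * (2 * (consts.C3act * consts.ε₁))) * ((1 - (1 / 200 : ℝ))⁻¹ ^ 2 * 2) * (1 + (1 / 400 : ℝ)) ^ 2 :=
    mul_nonneg (mul_nonneg (mul_nonneg (by norm_num) (mul_nonneg (by positivity) (mul_nonneg (by norm_num) c29))) (by norm_num)) (by positivity)
  -- hKP (strict, dag-n18-c) and hsmall2 (factor 2 against the slack e^{−5} at r₁ ≤ consts.κ − 1)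
  have hKP : consts.C3act * consts.ε₁ * Real.exp (5 * r₁ + 1) * K₀ 64 8 * 9 * 64 < 1 := strictKP_of_le_one_of_lt c29 c31 (by linarith)
  have hK : 0 ≤ K₀ 64 8 := (K₀_pos 64 8).le
  have hAK : 0 ≤ consts.C3act * consts.ε₁ * K₀ 64 8 * 9 * 64 := mul_nonneg (mul_nonneg (mul_nonneg c29 hK) (by norm_num)) (by norm_num)
  have hsmall2 : 2 * (consts.C3act * consts.ε₁) * Real.exp (5 * r₁ + 1) * K₀ 64 8 * 9 * 64 ≤ 1 := by
    have hexp : Real.exp (5 * r₁ + 1) ≤ Real.exp (-5) * Real.exp (5 * consts.κ + 1) := by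
      rw [← Real.exp_add]; exact Real.exp_le_exp.2 (by linarith)
    have he5 : Real.exp (-5) ≤ 1 / 2 := by
      have h2 : (2 : ℝ) ≤ Real.exp 5 := by linarith [Real.add_one_le_exp (5 : ℝ)]
      rw [Real.exp_neg, one_div]
      exact inv_anti₀ (by norm_num) h2
    have hT : consts.C3act * consts.ε₁ * Real.exp (5 * r₁ + 1) * K₀ 64 8 * 9 * 64 ≤
        Real.exp (-5) * (consts.C3act * consts.ε₁ * Real.exp (5 * consts.κ + 1) * K₀ 64 8 * 9 * 64) := by
      have h1 : consts.C3act * consts.ε₁ * Real.exp (5 * r₁ + 1) * K₀ 64 8 * 9 * 64 =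
          (consts.C3act * consts.ε₁ * K₀ 64 8 * 9 * 64) * Real.exp (5 * r₁ + 1) := by ring
      have h2 : Real.exp (-5) * (consts.C3act * consts.ε₁ * Real.exp (5 * consts.κ + 1) * K₀ 64 8 * 9 * 64) =
          (consts.C3act * consts.ε₁ * K₀ 64 8 * 9 * 64) * (Real.exp (-5) * Real.exp (5 * consts.κ + 1)) := by ring
      rw [h1, h2]
      exact mul_le_mul_of_nonneg_left hexp hAK
    have hP : 0 ≤ consts.C3act * consts.ε₁ * Real.exp (5 * consts.κ + 1) * K₀ 64 8 * 9 * 64 :=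
      mul_nonneg (mul_nonneg (mul_nonneg (mul_nonneg c29 (Real.exp_pos _).le) hK) (by norm_num)) (by norm_num)
    have h3 : Real.exp (-5) * (consts.C3act * consts.ε₁ * Real.exp (5 * consts.κ + 1) * K₀ 64 8 * 9 * 64) ≤ 1 / 2 * 1 :=
      mul_le_mul he5 c31 hP (by norm_num)
    calc 2 * (consts.C3act * consts.ε₁) * Real.exp (5 * r₁ + 1) * K₀ 64 8 * 9 * 64
        = 2 * (consts.C3act * consts.ε₁ * Real.exp (5 * r₁ + 1) * K₀ 64 8 * 9 * 64) := by ring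
      _ ≤ 2 * (1 / 2 * 1) := by linarith
      _ = 1 := by norm_num
  -- hC1, hrate, hκ₀, signs
  have hC1 : 4 * mstar * cw / 1 < 1 := by
    rw [div_one, hcwdef, mul_one_div, div_lt_one (by linarith)]
    linarith
  have hrate : r₁ + 2 * (64 * Real.log 162) + 2 ≤ (1 - 8 * consts.δ) * ((consts.L : ℝ) / 2) * consts.κ := by linarith
  have hκ₀ : kappa₀ (4 * 2 ^ 4) (2 * 4) ≤ κ / 2 := by
    rw [hκdef]
    have h : kappa₀ (4 * 2 ^ 4) (2 * 4) * 1 ≤ kappa₀ (4 * 2 ^ 4) (2 * 4) * (4 * (M : ℝ)) :=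
      mul_le_mul_of_nonneg_left (by linarith only [hM1]) hκ₀0
    calc kappa₀ (4 * 2 ^ 4) (2 * 4) = kappa₀ (4 * 2 ^ 4) (2 * 4) * 1 := (mul_one _).symm
      _ ≤ kappa₀ (4 * 2 ^ 4) (2 * 4) * (4 * (M : ℝ)) := h
      _ = 8 * (M : ℝ) * kappa₀ (4 * 2 ^ 4) (2 * 4) / 2 := by ring
  -- the bill's letter record: `C₉ := max 0 (hC₉'s left side)`
  set Bq : ℝ := 2 * (Real.exp 1 * 9 * 64 * K₀ 64 8 ^ 2 * (2 * (consts.C3act * consts.ε₁))) * ((1 - (1 / 200 : ℝ))⁻¹ ^ 2 * (2 : ℝ)) *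
    (1 + (1 / 400 : ℝ)) ^ 2 with hBqdef
  have hBq0 : 0 ≤ Bq := by
    rw [hBqdef]
    exact mul_nonneg (mul_nonneg (mul_nonneg (by norm_num) (mul_nonneg (by positivity) (mul_nonneg (by norm_num) c29))) (by norm_num))
      (by positivity)
  set X : ℝ := (4 * (2 * C₅ / (1 - θ₅) + 2 * ((16 * mstar * B₃ ^ 2 / r ^ 2) *
      Real.exp (delta1 δ₀ κ ((M : ℝ) * 4) * ((M : ℝ) * 4) * 3) * K₀ (4 * 2 ^ 4) (2 * 4) * K₁ 4 (δ₀ / 2))) / γ +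
      ((16 * max ((6 * (1 / 400 : ℝ) ^ 2 + 32 * (1 / 400 : ℝ) + 64) / (1 / 400 : ℝ) ^ 2 * Bq)
        (64 * mstar * cw ^ 2 / (1 : ℝ) ^ 2 * (Bq * γ / (1 / 400 : ℝ)) ^ 2 / (1 - 4 * mstar * cw / (1 : ℝ))) * B₃ ^ 2 / r ^ 2) *
        Real.exp (delta1 δ₀ κ ((M : ℝ) * 4) * ((M : ℝ) * 4) * 3) * K₀ (4 * 2 ^ 4) (2 * 4) * K₁ 4 (δ₀ / 2)) * γ / 2) / ω with hXdef
  let ℓ : U3Letters₁₁ := ⟨delta1 δ₀ κ ((M : ℝ) * 4), θ₅, 0, max 0 X, ω, 0, ω⟩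
  have hℓθ : ℓ.θ₅ = θ₅ := rfl
  have hℓω : ℓ.ω = ω := rfl
  have hℓκ : ℓ.κ = delta1 δ₀ κ ((M : ℝ) * 4) := rfl
  have hℓC : ℓ.C₉ = max 0 X := rfl
  have hsigns : ℓ.Signs := ⟨hd1, hθ₅, hθ₅1, le_rfl, le_max_left _ _, hω0.le, hω1, le_rfl, hθρ, le_rfl, hω1⟩
  have hC₉ : (4 * (2 * C₅ / (1 - ℓ.θ₅) + 2 * ((16 * mstar * B₃ ^ 2 / r ^ 2) *
      Real.exp (delta1 δ₀ κ ((M : ℝ) * 4) * ((M : ℝ) * 4) * 3) * K₀ (4 * 2 ^ 4) (2 * 4) * K₁ 4 (δ₀ / 2))) / γ +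
      ((16 * max ((6 * (1 / 400 : ℝ) ^ 2 + 32 * (1 / 400 : ℝ) + 64) / (1 / 400 : ℝ) ^ 2 * Bq)
        (64 * mstar * cw ^ 2 / (1 : ℝ) ^ 2 * (Bq * γ / (1 / 400 : ℝ)) ^ 2 / (1 - 4 * mstar * cw / (1 : ℝ))) * B₃ ^ 2 / r ^ 2) *
        Real.exp (delta1 δ₀ κ ((M : ℝ) * 4) * ((M : ℝ) * 4) * 3) * K₀ (4 * 2 ^ 4) (2 * 4) * K₁ 4 (δ₀ / 2)) * γ / 2) / ℓ.ω ≤ ℓ.C₉ := by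
    rw [hℓθ, hℓω, hℓC, ← hXdef]; exact le_max_right _ _
  refine ⟨ℓ, B13Lemma3WindowNonvacuity.aw + 40 * (M : ℝ), κ, κ, δ₀, cw * E₀ + 2, 1, mstar, cw, 1 / 400, 1 / 200, 2, Bq, cw,
    fun _ _ _ => cw, fun _ => univ, 𝔇, χu, χcu, 𝒲, 𝒪, ?_⟩
  have hfl : kappa₀ (4 * 2 ^ 4) (2 * 4) ≤ ℓ.κ := by rw [hℓκ, hd1eq]
  refine ⟨hℓθ, hsigns, hfl, c1, consts_L, c40, c4.ne', lemma3Numerics_consts_anyM M, hκ₀, hδ₀, le_rfl, hκpos.le, hm0.trans hE₀, ?_⟩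
  refine ⟨c29, hr₁0, hrate, hKP, hr₁, le_rfl, hE₀, fun _ _ _ => le_rfl, hC1, hm0, one_pos, by linarith, ?_⟩
  refine ⟨by norm_num, by norm_num, by norm_num, by norm_num, hBq0, hsmall2, by norm_num, ?_, by norm_num, ?_⟩
  · -- hBqv
    rw [hBqdef]
  refine ⟨hcw0, fun _ _ _ => le_rfl, hd1κ₅, ?_, ?_, ?_, hC₉, fun _ _ _ => mem_univ _, hlaw, hBox, hχ1, hWm, hιc⟩
  · rw [hℓω]; exact hω0
  · rw [hℓθ, hℓω]; exact hθω
  · rw [hℓκ]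

/-! ## §3 ★ The same at the block size of the record — J89's `hLc : c.L = L` VERBATIM (as module J90 v1.1 §3) -/

open Classical in
/-- ★ **THE SAME WITH `hLc` VERBATIM** — for every `L` WITH `consts.L = L` (i.e. `L = 8`) and every `F M sp γ θ₅ κ₅ C₅ B₃ r E₀ r₁` as in §2 (`κ₀′ ≤ κ₅`,
`8Mκ₀′ ≤ r₁ ≤ consts.κ − 1`): the floor `κ₀′ ≤ ℓ.κ` AND all non-owner binders of J89 with `hLc` returned as the conjunct `consts.L = L` — §2 repackaged, one line.
A2 bookkeeping; nothing of Bałaban's; N22 NOT discharged.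
[cite: Balaban1988RG2Cluster, p.21 (closing paragraph: "The assumptions allow finally us to fix all the constants")] -/
theorem socketNonOwnerBinders_inhabited_onFloor_atBlockSize (M L : ℕ) [NeZero M] [NeZero L] (hLc : consts.L = L) (sp : (K j : ℕ) → (domSys (F.P K) M j).Dom → Set (CPair (F.P K) 𝔸))
    (γ : ℝ) {θ₅ κ₅ : ℝ} (C₅ B₃ r : ℝ) {E₀ r₁ : ℝ} (hθ₅ : 0 < θ₅) (hθ₅1 : θ₅ < 1) (hκ₅ : kappa₀ (4 * 2 ^ 4) (2 * 4) ≤ κ₅)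
    (hE₀ : Real.exp 1 * 9 * 64 * K₀ 64 8 ^ 2 * (consts.C3act * consts.ε₁) ≤ E₀)
    (hr₁ : 8 * (M : ℝ) * kappa₀ (4 * 2 ^ 4) (2 * 4) ≤ r₁) (hr₁' : r₁ ≤ consts.κ - 1) :
    ∃ (ℓ : U3Letters₁₁) (a κ κE δ₀ R ϱ Mb cw cS cA Mv Bq b : ℝ) (aw : ℕ → ℕ → ℕ → ℝ) (D : ℕ → Set ℂ)
      (𝔇 : (K : ℕ) → TermData214 consts (F.P K) 𝔸 M L) (χu χcu : (K k : ℕ) → (𝔇 K k).UnscaledChi) (𝒲 : (K k : ℕ) → (𝔇 K k).UnscaledWilson)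
      (𝒪 : (K k : ℕ) → (𝔇 K k).UnscaledOlder),
      -- the bill's letter record carries N18's rate and the displayed signs, AND ITS KERNEL LETTER SITS ON THE CENSUS FLOOR (`hlink` ∕ node N27's `hκ₀`)
      ℓ.θ₅ = θ₅ ∧ ℓ.Signs ∧ kappa₀ (4 * 2 ^ 4) (2 * 4) ≤ ℓ.κ ∧
      -- hL hLc hκ₁ hα₆ hN : the numerics record of record (`hLc` VERBATIM: `consts.L = L`)
      8 ≤ consts.L ∧ consts.L = L ∧ 1 ≤ consts.κ₁ ∧ consts.α₆ ≠ 0 ∧ Lemma3Numerics consts M ((consts.L : ℝ) / 2) a 1 1 (1 / 2) 1 ∧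
      -- hκ₀ hδ₀ hκE hκE0 hE₀
      kappa₀ (4 * 2 ^ 4) (2 * 4) ≤ κ / 2 ∧ 0 < δ₀ ∧ κ ≤ κE ∧ 0 ≤ κE ∧ 0 ≤ E₀ ∧
      -- hA0 hr₁ hrate hKP hκr hrenew hrenewE hawcw hC1 hMb0 hϱ hR
      0 ≤ consts.C3act * consts.ε₁ ∧ 0 ≤ r₁ ∧ r₁ + 2 * (64 * Real.log 162) + 2 ≤ (1 - 8 * consts.δ) * ((consts.L : ℝ) / 2) * consts.κ ∧
      consts.C3act * consts.ε₁ * Real.exp (5 * r₁ + 1) * K₀ 64 8 * 9 * 64 < 1 ∧ κE ≤ r₁ ∧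
      Real.exp 1 * 9 * 64 * K₀ 64 8 ^ 2 * (consts.C3act * consts.ε₁) ≤ Mb ∧ Real.exp 1 * 9 * 64 * K₀ 64 8 ^ 2 * (consts.C3act * consts.ε₁) ≤ E₀ ∧
      (∀ K k j : ℕ, aw K k j ≤ cw) ∧ 4 * Mb * cw / ϱ < 1 ∧ 0 ≤ Mb ∧ 0 < ϱ ∧ cw * E₀ + ϱ < R ∧
      -- hcS hcSA hcA1 hρb hBq hsmall2 hMv hBqv hρb1 (ρ_b = 1∕100)
      0 < cS ∧ cS < cA ∧ cA < 1 ∧ cA / (1 - cA) < (1 / 100 : ℝ) ∧ 0 ≤ Bq ∧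
      2 * (consts.C3act * consts.ε₁) * Real.exp (5 * r₁ + 1) * K₀ 64 8 * 9 * 64 ≤ 1 ∧ 0 ≤ Mv ∧
      2 * (Real.exp 1 * 9 * 64 * K₀ 64 8 ^ 2 * (2 * (consts.C3act * consts.ε₁))) * ((1 - cA)⁻¹ ^ 2 * Mv) * (1 + cS) ^ 2 ≤ Bq ∧ (1 / 100 : ℝ) < 1 ∧
      -- hb hbaw
      0 < b ∧ (∀ K k j : ℕ, b ≤ aw K k j) ∧
      -- hκ₅ hω hθω hℓκ hC₉ (θ.γ := γ)
      delta1 δ₀ κ ((M : ℝ) * 4) ≤ κ₅ ∧ 0 < ℓ.ω ∧ ℓ.θ₅ ≤ ℓ.ω ^ 2 ∧ ℓ.κ ≤ delta1 δ₀ κ ((M : ℝ) * 4) ∧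
      (4 * (2 * C₅ / (1 - ℓ.θ₅) + 2 * ((16 * Mb * B₃ ^ 2 / r ^ 2) * Real.exp (delta1 δ₀ κ ((M : ℝ) * 4) * ((M : ℝ) * 4) * 3) * K₀ (4 * 2 ^ 4) (2 * 4) * K₁ 4 (δ₀ / 2))) / γ +
        ((16 * max ((6 * cS ^ 2 + 32 * cS + 64) / cS ^ 2 * Bq) (64 * Mb * cw ^ 2 / ϱ ^ 2 * (Bq * γ / cS) ^ 2 / (1 - 4 * Mb * cw / ϱ)) * B₃ ^ 2 / r ^ 2) *
          Real.exp (delta1 δ₀ κ ((M : ℝ) * 4) * ((M : ℝ) * 4) * 3) * K₀ (4 * 2 ^ 4) (2 * 4) * K₁ 4 (δ₀ / 2)) * γ / 2) / ℓ.ω ≤ ℓ.C₉ ∧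
      -- hD
      (∀ K : ℕ, ∀ t ∈ Ioc (0 : ℝ) γ, ((t : ℝ) : ℂ) ∈ D K) ∧
      -- hlaw hBox hχ1 hWm hιc (module J88-W′ §2)
      (∀ K, (𝔇 K).UnscaledFieldLawOn (χu K) (χcu K) (𝒲 K) (𝒪 K) γ) ∧
      (∀ (K k : ℕ) (Z : (domSys (F.P K) M (k + 1)).Dom) (s : TermLabel (F.P K) M k L), (𝔇 K k).UnscaledBoxLaws (χu K k) (χcu K k) Z s) ∧
      (∀ (K k : ℕ) (Z : (domSys (F.P K) M (k + 1)).Dom) (s : TermLabel (F.P K) M k L) (A : ((𝔇 K k).𝒦 Z s).Λ → ℝ), χu K k Z s A * χcu K k Z s A ≤ 1) ∧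
      (∀ (K k : ℕ) (Z : (domSys (F.P K) M (k + 1)).Dom) (t : TermLabel (F.P K) M k L) (φ : CPair (F.P K) 𝔸) (Y : TDom (F.P K).d (L * domCount (F.P K) M (k + 1))),
        Measurable fun B : ((𝔇 K k).𝒦 Z t).Λ → ℝ => 𝒲 K k Z t φ Y B) ∧
      (∀ (K k : ℕ) (old : OlderTerms (F.P K) 𝔸 M k), old ∈ AdmHist (sp K) E₀ r₁ k ∧ old 0 = 0 → ∀ (X : (domSys (F.P K) M (k + 1)).Dom), ∀ φ ∈ sp K (k + 1) X,
      ∀ Z : (domSys (F.P K) M (k + 1)).Dom, Subtype.val Z ⊆ Subtype.val X → ∀ s ∈ terms L M Z, ∀ t ∈ Ioc (0 : ℝ) γ,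
        ∃ ι : (𝔇 K k).Inputs226Holo consts Z s ((t : ℝ) : ℂ) old φ a (1 / 2), ∃ ag : (𝔇 K k).AnalyticGrowthInputs (χu K k) (𝒲 K k) (𝒪 K k) Z s old φ ι.Uτ,
        ∃ KE KG' KCs' θΓ' θC' θE' am wm δ : ℝ,
          0 ≤ KE ∧
          (∀ b b', ‖(((𝔇 K k).𝒦 Z s).C⁻¹.map (algebraMap ℝ ℂ)) b b'‖ ≤
            KE * Real.exp (-(ι.kap * tdist1 (𝔇 K k).Nf (((𝔇 K k).𝒦 Z s).locΛ b) (((𝔇 K k).𝒦 Z s).locΛ b')))) ∧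
          (1 + (1 / 100 : ℝ)) * ι.KG ≤ KG' ∧ ((1 - (1 / 100 : ℝ)) ^ 2)⁻¹ * ι.KCs ≤ KCs' ∧ ι.θΓ + (1 / 100 : ℝ) * ι.KG ≤ θΓ' ∧
          ι.θC + (1 / 100 : ℝ) * (2 + (1 / 100 : ℝ)) * ((1 - (1 / 100 : ℝ)) ^ 2)⁻¹ * ι.KCs ≤ θC' ∧ ι.θE + (1 / 100 : ℝ) * (2 + (1 / 100 : ℝ)) * (ι.θE + KE) ≤ θE' ∧ θE' ≤ ι.θ ∧ θΓ' ≤ ι.θ ∧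
          ((((𝔇 K k).𝒦 Z s).m * (1 + 2 / (ι.kap - ι.kap')) ^ (𝔇 K k).ν) * (((𝔇 K k).𝒦 Z s).m * (1 + 2 / (ι.kap' - ι.kap'')) ^ (𝔇 K k).ν)
            * (θΓ' * KCs' * KG' + ι.KΓ * θC' * KG' + ι.KΓ * ι.K₀ * θΓ') ≤ ι.θ) ∧
          (1 + (1 / 100 : ℝ)) ^ 2 * (2 * ag.ρ * (ag.Cp * K₀ (4 * 2 ^ (F.P K).d) (2 * (F.P K).d))) ≤ am ∧ (1 + (1 / 100 : ℝ)) ^ 2 * (∑ Y ∈ s.1, ag.Rτ Y * (ag.M𝒪 Y + (2 * ag.M𝒪 Y / ag.R) * ag.ρ)) ≤ wm ∧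
          0 < δ ∧ 2 * δ + 8 * ag.ρ * (ag.Cp * K₀ (4 * 2 ^ (F.P K).d) (2 * (F.P K).d)) ≤ am ∧
          Real.exp (∑ Y ∈ s.1, ag.Rτ Y * ag.M𝒪 Y)
              * ((∑ Y ∈ s.1, ag.Rτ Y * ((4 * (2 * ag.M𝒲 Y / ag.R ^ 4) + (4 * (ag.M𝒲 Y / ag.R ^ 3) + 4 * (ag.M𝒲 Y / ag.R ^ 3)) / ag.ρ) * (4 / (Real.exp 1 * δ)) ^ 4
                    + ((4 * ag.M𝒪 Y / ag.R ^ 2) + ((2 * ag.M𝒪 Y / ag.R) + (2 * ag.M𝒪 Y / ag.R)) / ag.ρ) * (2 / (Real.exp 1 * δ)) ^ 2)) * Real.exp (δ / 2)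
                 + ((∑ Y ∈ s.1, ag.Rτ Y * (4 * (ag.M𝒲 Y / ag.R ^ 3) * (3 / (Real.exp 1 * δ)) ^ 3 + (2 * ag.M𝒪 Y / ag.R) * (1 / (Real.exp 1 * δ))))
                      * Real.exp (δ / 2)) ^ 2
                    * Real.exp ((∑ Y ∈ s.1, ag.Rτ Y * (ag.M𝒪 Y + (2 * ag.M𝒪 Y / ag.R) * ag.ρ)) + ∑ Y ∈ s.1, ag.Rτ Y * ag.M𝒪 Y))
              ≤ Real.exp wm ∧
          (2 * (ι.θ * (((𝔇 K k).𝒦 Z s).m * (1 + 2 / ι.kap'') ^ (𝔇 K k).ν)) + (ι.γ₂ + am)) * ι.cE ≤ 1 / 2 ∧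
          (2 * (ι.θ * (((𝔇 K k).𝒦 Z s).m * (1 + 2 / ι.kap'') ^ (𝔇 K k).ν)) + (ι.γ₂ + am)) * (1 + 2 * ι.cE * ι.g) ≤ 1 / 2 ∧
          2 * (ι.K₀ * (((𝔇 K k).𝒦 Z s).m * (1 + 2 / ι.kap) ^ (𝔇 K k).ν) * (ι.θ * (((𝔇 K k).𝒦 Z s).m * (1 + 2 / ι.kap'') ^ (𝔇 K k).ν))
              * (1 + (1 - ι.K₀ * (((𝔇 K k).𝒦 Z s).m * (1 + 2 / ι.kap) ^ (𝔇 K k).ν) * (ι.θ * (((𝔇 K k).𝒦 Z s).m * (1 + 2 / ι.kap'') ^ (𝔇 K k).ν)))⁻¹) / 2)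
              * (Fintype.card ((𝔇 K k).𝒦 Z s).Λ : ℝ)
            + wm + (2 * (ι.θ * (((𝔇 K k).𝒦 Z s).m * (1 + 2 / ι.kap'') ^ (𝔇 K k).ν)) + (ι.γ₂ + am)) * ι.cE * (Fintype.card ((𝔇 K k).𝒦 Z s).Λ : ℝ)
            + (2 * (ι.θ * (((𝔇 K k).𝒦 Z s).m * (1 + 2 / ι.kap'') ^ (𝔇 K k).ν)) + (ι.γ₂ + am)) * (1 + 2 * ι.cE * ι.g)
              * (Fintype.card (((𝔇 K k).𝒦 Z s).Λ ⊕ ((𝔇 K k).𝒦 Z s).C₀) : ℝ)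
            ≤ 1 / 2 * ((Z.1).card : ℝ) ∧
          (s.2.card = 0 → ∃ κb Rb T : ℝ, 0 ≤ κb ∧ κb ≤ ι.γ₂ + am ∧
            (∀ B : ((𝔇 K k).𝒦 Z s).Λ → ℝ, B ⬝ᵥ B < Rb ^ 2 → χu K k Z s (t • B) * χcu K k Z s (t • B) = 1) ∧
            Real.exp (-(κb / 2 * Rb ^ 2)) ≤ T * t ^ 2 ∧ 1 + T ≤ Mv) ∧
          (s.2.card ≠ 0 → ∃ r₁' T' : ℝ, r₁' ^ 2 ≤ ι.rP ^ 2 ∧ a ≤ ι.γ₂ * r₁' ^ 2 ∧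
            Real.exp (-(ι.γ₂ / 2 * (ι.rP ^ 2 - r₁' ^ 2))) ≤ T' * t ^ 2 ∧ T' ≤ Mv)) := by
  obtain ⟨ℓ, a, κ, κE, δ₀, R, ϱ, Mb, cw, cS, cA, Mv, Bq, b, aw, D, 𝔇, χu, χcu, 𝒲, 𝒪, h1, h2, hf, h3, -, hrest⟩ :=
    socketNonOwnerBinders_inhabited_onFloor F M L sp γ C₅ B₃ r hθ₅ hθ₅1 hκ₅ hE₀ hr₁ hr₁'
  exact ⟨ℓ, a, κ, κE, δ₀, R, ϱ, Mb, cw, cS, cA, Mv, Bq, b, aw, D, 𝔇, χu, χcu, 𝒲, 𝒪, h1, h2, hf, h3, hLc, hrest⟩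

end YMDAG.N22.KernelFading

end
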